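import Mathlib.Data.Matrix.Block
import Mathlib.LinearAlgebra.Matrix.SemiringInverse
import Mathlib.LinearAlgebra.Matrix.Notation
import Mathlib.Tactic.NoncommRing
import HarnessLib

/-!
# Golyshev–Lunts–Orlov's complex structure `I_ω` on `Λ_ℝ = V_A ⊕ V_Â` in block form: display (14) is a
# conjugate of `(0 −φ₂⁻¹; φ₂ 0)` by `(1 0; φ₁ 1)`; `I_ω² = −1`; `I_{ω̄} = −I_ω`; `I_ω` is `Q`-orthogonal and
# commutes with `J_{A×Â}`; Lemma 9.4.1's block relations and its reconstruction `I = I_ω`; the `sl(2)`-triple of 7.3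

Venture cell `pub-hsemireg`, literature seat `lit-w-polishchuk-orlov` (g13, 2026-08-25). Companion of
`OrlovIsometricLatticeGraph.lean` ([Orl02] Prop. 2.21) and `KapustinOrlovToriComplexStructures.lean` ([KO03] §2.1);
neither is imported — every statement below is about explicit block matrices `Matrix.fromBlocks`.

PRINTED ([GolyshevLuntsOrlov2001MirrorAV] = V. Golyshev, V. Lunts, D. Orlov, «Mirror symmetry for abelian
varieties», J. Algebraic Geom. 10 (2001) 433–496; quoted from the authors' arXiv text math/9812003v2, page images read
2026-08-25, `widen/LIT-W/texts-po/BYEYE-LOG-g13-glo01-concordance.md`):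
* §3.1 (p. 7): `Λ = Γ ⊕ Γ*` with «the canonical symmetric bilinear form `Q((a₁, b₁), (a₂, b₂)) = b₁(a₂) + b₂(a₁)` …
  This form is even and unimodular. Moreover, `Q ≃ U^{2n}`, where `U = (0 1; 1 0)`.»
* Rem. 1.6 (p. 6): for `f : A → B` «the matrices `F` and `F̂` are transposes of each other, i.e. `F̂ = Fᵗ`»; for
  `f : A → Â` «skew-transposes of each other, i.e. `F̂ = −Fᵗ` … Thus, in particular, `φ̂_L = φ_L` for any
  `L ∈ Pic_A`»; Prop. 4.3.2 (p. 16): «`U(A) = O(Λ, Q) ∩ Aut(A × Â) = SO(Λ, Q) ∩ Aut(A × Â)`», whose proof prints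
  «the group `O(Λ, Q)` consists of matrices `(α β; γ δ)` such that `(α β; γ δ)(0 1; 1 0)(αᵗ γᵗ; βᵗ δᵗ) = (0 1; 1 0)`.
  The equality `T = O(Λ, Q)` now follows from Remark 1.6»; Prop. 5.2 (pp. 19–20): «3) `U_{A,ℚ} = Aut_ℚ(A × Â) ∩
  SO(Λ_ℚ, Q_ℚ)`. 4) `U_{A,ℚ}` is the centralizer of `Hdg_{A,ℚ}` in `SO(Λ_ℚ, Q_ℚ)`», proof of 1): «The operator `J_A`
  of complex structure on `Λ_ℝ` has determinant `1` and preserves the form `Q`».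
* §8.4 (p. 24), display (14): «Given `ω = φ₁ + iφ₂ ∈ NS_A(ℂ)⁰` consider the following element
  `I_ω := (φ₂⁻¹φ₁ −φ₂⁻¹; φ₂ + φ₁φ₂⁻¹φ₁ −φ₁φ₂⁻¹) = (1 0; φ₁ 1)(0 −φ₂⁻¹; φ₂ 0)(1 0; −φ₁ 1) ∈ U_{A,ℚ}(ℝ)`» (here
  `NS_A(ℂ)⁰ = {φ₁ + iφ₂ ∣ φ₂ ∈ NS_A(ℝ)⁰}`, `NS_A(ℝ)⁰ ⊂ NS_A(ℝ) ⊂ Hom(A, Â) ⊗ ℝ` the non-degenerate forms); 8.4.1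
  «Properties of `I_ω` … (1) `I_{ω̄} = −I_ω` … This is obvious. (2) `I_ω² = −Id`. This is a direct computation.»;
  §9.1 (p. 25): «`J_{A×Â} ∈ Hdg_{A,ℚ}(ℝ) = Hdg_{A×Â,ℚ}(ℝ)`, `I_{ω_A} ∈ U_{A,ℚ}(ℝ)` (see 2.1, 8.4) which commute and
  define two complex structures on `V_A ⊕ V_Â`.»; 10.1.3 (p. 31), display (17): the same for `J(q)`, `J(q)² = −Id`.
* LEMMA 9.4.1 (p. 27): «Let `A` be a complex torus. Suppose `I ∈ U_{A,ℚ}(ℝ)`, `I² = −1` and `I` has the form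
  `(I₁₁ I₁₂; I₂₁ I₂₂)`. The following conditions are equivalent: 1) `I = I_ω` for some `ω ∈ NS_A(ℂ)⁰`. 2) `I₁₂ : V_Â →
  V_A` is invertible. 3) …»; its proof, p. 28 L1–2: «2) ⇒ 1) Let `I₁₂` is invertible. Since `I² = −1` and
  `I ∈ U_{A,ℚ}(ℝ)` we have equalities `Î₁₂ = I₁₂`, `Î₂₁ = I₂₁`, `Î₁₁ = −I₂₂`. Put `φ₂ = −I₁₂⁻¹` and `φ₁ = I₂₂I₁₂⁻¹`.
  Take `ω = φ₁ + iφ₂`. It is easy to see that `I_ω = I`.»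
* 7.3 (p. 23): «Let `φ ∈ NS_A(ℝ)⁰ ⊂ Hom(V_A, V_Â)`. Then `φ, φ⁻¹ ∈ g_NS(A; ℝ)` and `[φ, φ⁻¹] = h = (−1_A 0; 0 1_Â)`.
  The elements `φ, φ⁻¹, h` make up a Lie subalgebra `g_φ` of `g_NS(A; ℝ)` isomorphic to `sl(2)`.»
* [KapustinOrlov2003VertexAlgebrasTori] §2.2 (arXiv hep-th/0010293v2 p. 9 L23–L30): «if both `B` and `B′` are of type
  (1,1), the criterion for mirror symmetry is identical to the one proposed in [14]» (= [GLO01] Def. 9.2).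

MODEL (the one modelling step, ASSUMED — it is Rem. 1.6's dictionary, the same as in the two companions): a basis
`l₁ … l_{2n}` of `Γ_A = H₁(A, ℤ)` and the DUAL basis `x₁ … x_{2n}` of `Γ_Â = Γ_A*` are fixed and indexed by one finite
type `n`; an element of `End(Λ_ℝ)`, `Λ = Γ_A ⊕ Γ_Â`, is `Matrix.fromBlocks a b c d` over a commutative ring `R` (read
`ℝ`; `ℚ`, `ℤ` where meaningful) with `c : V_A → V_Â` the LOWER-LEFT block; `Q = (0 1; 1 0)`; a real Néron–Severi
class `φ ∈ NS_A(ℝ) ⊂ Hom(V_A, V_Â)` is an ANTISYMMETRIC matrix (`φᵀ = −φ`: `φ̂ = φ` with `φ̂ = −φᵀ`) of Hodge type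
(1,1), i.e. `φ J + Jᵀ φ = 0` for the complex structure `J = J_A` of `V_A` (`φ(Jx, Jy) = φ(x, y)`); `J_Â = −J_Aᵀ` in
the dual basis, so `J_{A×Â} = (J 0; 0 −Jᵀ)` (= Kapustin–Orlov's `𝓘̃`); an inverse `φ₂⁻¹` is carried as a second
matrix `φ₂'` with `φ₂ φ₂' = 1 = φ₂' φ₂`. Nothing below uses more than this dictionary.

## Results (PROVED; theorems only — no definition, no named fact, no `sorry`; imports Mathlib + HarnessLib)
* `iomega_eq_conj`: display (14) ∕ (17) **`(φ₂'φ₁ −φ₂'; φ₂ + φ₁φ₂'φ₁ −φ₁φ₂') = (1 0; φ₁ 1)(0 −φ₂'; φ₂ 0)(1 0; −φ₁ 1)`**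
  for ALL square `φ₁, φ₂, φ₂'` (no hypothesis) — PRINTED. Read against `KapustinOrlovToriComplexStructures.koJ_eq_omega`
  (`𝓙(G, I, B) = (ω'B −ω'; ω + Bω'B −Bω')`, `ω = GI`, `ω' = ω⁻¹`) it says **`I_{φ₁ + iφ₂} = 𝓙` with `B`-field `φ₁` and
  Kähler form `ω = φ₂`** — the matrix content of Kapustin–Orlov's «identical to the one proposed in [14]»; DERIVED.
* `iomega_sq` (8.4.1 (2), `J(q)² = −Id`): `φ₂ φ₂' = 1 = φ₂' φ₂ ⟹ I_ω² = −1`, any `φ₁`; `iomega_bar` (8.4.1 (1)):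
  `I_{ω̄} = −I_ω` (`φ₂, φ₂' ↦ −φ₂, −φ₂'`; no hypothesis) — PRINTED, proved here.
* `iomega_orthogonal`: `φ₁, φ₂` antisymmetric, `φ₂ φ₂' = 1 = φ₂' φ₂ ⟹ I_ωᵀ Q I_ω = Q` — the `O(Λ_ℝ, Q_ℝ)` half of
  «`I_ω ∈ U_{A,ℚ}(ℝ)`» (Prop. 5.2 3)); `transpose_inv_of_antisymm`: the inverse of an antisymmetric matrix is
  antisymmetric); `iomega_comm_J`: `φ₁ J + Jᵀ φ₁ = 0 = φ₂ J + Jᵀ φ₂`, `φ₂ φ₂' = 1 = φ₂' φ₂ ⟹ I_ω J_{A×Â} = J_{A×Â} I_ω`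
  — «which commute» (§9.1); with `jAxAhat_sq`, `jAxAhat_orthogonal` (`J² = −1 ⟹ J_{A×Â}² = −1`, `J_{A×Â}ᵀ Q J_{A×Â}
  = Q`: «`J_A` … preserves the form `Q`»). DERIVED HERE in the model.
* `blocks_of_orthogonal_sq_neg_one` (Lemma 9.4.1, proof l. 1–2): `Iᵀ Q I = Q ∧ I² = −1 ⟹ I₁₂ᵀ = −I₁₂ ∧ I₂₁ᵀ = −I₂₁
  ∧ I₁₁ᵀ = −I₂₂` (= «`Î₁₂ = I₁₂, Î₂₁ = I₂₁, Î₁₁ = −I₂₂`» under Rem. 1.6); `iomega_of_blocks` (Lemma 9.4.1, 2) ⇒ 1)):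
  **`I² = −1`, `I₁₂ K = 1 = K I₁₂ ⟹ I = I_ω` with `φ₁ = I₂₂ K`, `φ₂ = −K`, `φ₂' = −I₁₂`** — the printed recipe; note
  that the matrix identity needs `I² = −1` and the invertibility of `I₁₂` ONLY (membership in `U` is what makes
  `φ₁, φ₂` Néron–Severi classes, cf. `blocks_of_orthogonal_sq_neg_one`).
* `iomega_real_scaling` (Thm 10.5's `I_{tω}`): `t t' = 1 ⟹ I_{tω} = (φ₂'φ₁ −t'φ₂'; t(φ₂ + φ₁φ₂'φ₁) −φ₁φ₂')`, and
  `iomega_real_scaling_conj`: `= diag(1, t) I_ω diag(1, t')`; `iomega_scalar` (proof of Prop. 9.6.1, p. 29): for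
  `ω = (a + ib)φ`, `I_ω = (b'a −b'φ'; (b + ab'a)φ −ab')` (`b b' = 1`, `φ φ' = 1 = φ' φ`) — PRINTED displays.
* `ns_bracket_eq_h` (7.3): `φ φ' = 1 = φ' φ ⟹ [(0 0; φ 0), (0 φ'; 0 0)] = (−1 0; 0 1)`; `j0_conj_blocks` (display in
  the proof of Prop. 10.1.4, p. 31, no hypothesis).
* Non-vacuity over `ℤ` (`n = Fin 2`, `example_integral`): `φ₁ = φ₂ = J = (0 1; −1 0)`, `φ₂' = −φ₂` meet every
  hypothesis (`φ₂ φ₂' = 1`, antisymmetry, type (1,1), `J² = −1`), `I_ω = (1 φ; 2φ −1)` and `I_ω² = −1`, `I_ωᵀ Q I_ω =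
  Q`, `I_ω J_{A×Â} = J_{A×Â} I_ω`, `I_ω ≠ ±J_{A×Â}` — checked by `decide`.

HONEST FRAMING: identities between block matrices over a commutative ring; the dictionary «complex torus with
`ω = φ₁ + iφ₂` ↦ (`J`, `φ₁`, `φ₂`)» is the print's own (§§1.6, 3.1, 8.4) and is ASSUMED; nothing here constructs a
torus, a mirror pair, a derived category or `U_{A,ℚ}`, `Hdg_{A,ℚ}`, `Spin(A)`, and nothing says HC ∕ HC_CM ∕ HC_AV holds.
-/

namespace Summit.Ventures.HSemireg.GolyshevLuntsOrlov

open Matrix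

variable {R : Type*} [CommRing R] {n : Type*} [Fintype n] [DecidableEq n]

section Conjugation

omit [Fintype n] in
/-- `(−1) ⊕ (−1) = −1` on `Λ = Γ ⊕ Γ*`. -/
private theorem fromBlocks_neg_one_eq :
    fromBlocks (-1) 0 0 (-1) = (-1 : Matrix (n ⊕ n) (n ⊕ n) R) := by
  rw [← fromBlocks_one, fromBlocks_neg, neg_zero]

/-- `(1 0; −φ 1)(1 0; φ 1) = 1`. -/
theorem shear_neg_mul_shear (φ : Matrix n n R) :
    fromBlocks 1 0 (-φ) 1 * fromBlocks 1 0 φ 1 = (1 : Matrix (n ⊕ n) (n ⊕ n) R) := by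
  simp only [fromBlocks_multiply, Matrix.mul_one, Matrix.one_mul, Matrix.mul_zero, Matrix.zero_mul, add_zero,
    zero_add, neg_add_cancel, fromBlocks_one]

/-- Conjugation preserves `X² = −1`. -/
private theorem conj_sq (P Pinv X : Matrix (n ⊕ n) (n ⊕ n) R) (hP : Pinv * P = 1)
    (hX : X * X = -1) : (P * X * Pinv) * (P * X * Pinv) = -1 := by
  calc (P * X * Pinv) * (P * X * Pinv) = P * X * (Pinv * P) * X * Pinv := by
        simp only [Matrix.mul_assoc]
    _ = -1 * (P * Pinv) := by rw [hP, Matrix.mul_one, Matrix.mul_assoc P X X, hX]; noncomm_ring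
    _ = -1 := by rw [mul_eq_one_comm.mp hP, Matrix.mul_one]

/-- Conjugation by a `Q`-isometry preserves `Q`-isometries (`Q` any square matrix here). -/
private theorem conj_orthogonal (P Pinv X Q : Matrix (n ⊕ n) (n ⊕ n) R) (hP : Pinv * P = 1)
    (hPQ : Pᵀ * Q * P = Q) (hX : Xᵀ * Q * X = Q) :
    (P * X * Pinv)ᵀ * Q * (P * X * Pinv) = Q := by
  have hPinvQ : Pinvᵀ * Q * Pinv = Q := by
    have hP' : P * Pinv = 1 := mul_eq_one_comm.mp hP
    calc Pinvᵀ * Q * Pinv = Pinvᵀ * (Pᵀ * Q * P) * Pinv := by rw [hPQ]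
      _ = (P * Pinv)ᵀ * Q * (P * Pinv) := by rw [transpose_mul]; simp only [Matrix.mul_assoc]
      _ = Q := by rw [hP', transpose_one, Matrix.one_mul, Matrix.mul_one]
  calc (P * X * Pinv)ᵀ * Q * (P * X * Pinv)
        = Pinvᵀ * (Xᵀ * (Pᵀ * Q * P) * X) * Pinv := by
          rw [transpose_mul, transpose_mul]; simp only [Matrix.mul_assoc]
    _ = Q := by rw [hPQ, hX, hPinvQ]

/-- `P X P⁻¹` commutes with `Y` if `X` and `P` do. -/
private theorem conj_comm (P Pinv X Y : Matrix (n ⊕ n) (n ⊕ n) R) (hP : Pinv * P = 1)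
    (hPY : P * Y = Y * P) (hXY : X * Y = Y * X) : (P * X * Pinv) * Y = Y * (P * X * Pinv) := by
  have hP' : P * Pinv = 1 := mul_eq_one_comm.mp hP
  have hPinvY : Pinv * Y = Y * Pinv := by
    calc Pinv * Y = Pinv * Y * (P * Pinv) := by rw [hP', Matrix.mul_one]
      _ = Pinv * (Y * P) * Pinv := by simp only [Matrix.mul_assoc]
      _ = Pinv * (P * Y) * Pinv := by rw [hPY]
      _ = Y * Pinv := by rw [← Matrix.mul_assoc, hP, Matrix.one_mul]
  calc P * X * Pinv * Y = P * X * (Pinv * Y) := by simp only [Matrix.mul_assoc]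
    _ = P * (X * Y) * Pinv := by rw [hPinvY]; simp only [Matrix.mul_assoc]
    _ = P * (Y * X) * Pinv := by rw [hXY]
    _ = (P * Y) * X * Pinv := by simp only [Matrix.mul_assoc]
    _ = Y * (P * X * Pinv) := by rw [hPY]; simp only [Matrix.mul_assoc]

end Conjugation

section Iomega

/-- **Display (14) ∕ (17)**: `I_ω = (φ₂⁻¹φ₁ −φ₂⁻¹; φ₂ + φ₁φ₂⁻¹φ₁ −φ₁φ₂⁻¹) = (1 0; φ₁ 1)(0 −φ₂⁻¹; φ₂ 0)(1 0; −φ₁ 1)`, with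
`φ₂⁻¹` an arbitrary matrix `φ₂'` — the factorisation needs no hypothesis
[cite: GolyshevLuntsOrlov2001MirrorAV, §8.4 display (14) (arXiv v2 p. 24); §10.1.3 display (17) (p. 31)]. -/
theorem iomega_eq_conj (φ₁ φ₂ φ₂' : Matrix n n R) :
    fromBlocks (φ₂' * φ₁) (-φ₂') (φ₂ + φ₁ * φ₂' * φ₁) (-(φ₁ * φ₂')) =
      fromBlocks 1 0 φ₁ 1 * fromBlocks 0 (-φ₂') φ₂ 0 * fromBlocks 1 0 (-φ₁) 1 := by
  simp only [fromBlocks_multiply, Matrix.mul_one, Matrix.one_mul, Matrix.mul_zero, Matrix.zero_mul, add_zero,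
    zero_add, Matrix.neg_mul, Matrix.mul_neg, neg_neg, Matrix.mul_assoc]

/-- `(0 −φ₂⁻¹; φ₂ 0)² = −1`. -/
theorem j0_sq {φ₂ φ₂' : Matrix n n R} (h : φ₂ * φ₂' = 1) (h' : φ₂' * φ₂ = 1) :
    fromBlocks 0 (-φ₂') φ₂ 0 * fromBlocks 0 (-φ₂') φ₂ 0 = -1 := by
  simp only [fromBlocks_multiply, Matrix.mul_zero, Matrix.zero_mul, add_zero, zero_add, Matrix.neg_mul,
    Matrix.mul_neg, h, h', neg_zero, fromBlocks_neg_one_eq]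

/-- **8.4.1 (2)** «`I_ω² = −Id`. This is a direct computation.» — in the model: `φ₂ φ₂' = 1 = φ₂' φ₂ ⟹ I_ω² = −1`
for every `φ₁` [cite: GolyshevLuntsOrlov2001MirrorAV, 8.4.1 (2) (arXiv v2 p. 24); «J(q)² = −Id» 10.1.3 (p. 31)].
PROVED HERE via the factorisation (14). -/
theorem iomega_sq {φ₂ φ₂' : Matrix n n R} (h : φ₂ * φ₂' = 1) (h' : φ₂' * φ₂ = 1) (φ₁ : Matrix n n R) :
    fromBlocks (φ₂' * φ₁) (-φ₂') (φ₂ + φ₁ * φ₂' * φ₁) (-(φ₁ * φ₂')) *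
      fromBlocks (φ₂' * φ₁) (-φ₂') (φ₂ + φ₁ * φ₂' * φ₁) (-(φ₁ * φ₂')) = -1 := by
  rw [iomega_eq_conj]
  exact conj_sq _ _ _ (shear_neg_mul_shear φ₁) (j0_sq h h')

omit [DecidableEq n] in
/-- **8.4.1 (1)** «`I_{ω̄} = −I_ω`» (`ω̄ = φ₁ − iφ₂`: replace `φ₂, φ₂⁻¹` by `−φ₂, −φ₂⁻¹`) — no hypothesis
[cite: GolyshevLuntsOrlov2001MirrorAV, 8.4.1 (1) (arXiv v2 p. 24)]. -/
theorem iomega_bar (φ₁ φ₂ φ₂' : Matrix n n R) :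
    fromBlocks ((-φ₂') * φ₁) (-(-φ₂')) (-φ₂ + φ₁ * (-φ₂') * φ₁) (-(φ₁ * (-φ₂'))) =
      -fromBlocks (φ₂' * φ₁) (-φ₂') (φ₂ + φ₁ * φ₂' * φ₁) (-(φ₁ * φ₂')) := by
  simp only [fromBlocks_neg, Matrix.neg_mul, Matrix.mul_neg, neg_neg, neg_add]

/-- The inverse of an antisymmetric matrix is antisymmetric. -/
theorem transpose_inv_of_antisymm {φ φ' : Matrix n n R} (hφ : φᵀ = -φ) (h : φ * φ' = 1) :
    φ'ᵀ = -φ' := by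
  have h1 : φ'ᵀ * φ = -1 := by
    have hT := congrArg transpose h
    rw [transpose_mul, transpose_one, hφ, Matrix.mul_neg, neg_eq_iff_eq_neg] at hT
    exact hT
  calc φ'ᵀ = φ'ᵀ * (φ * φ') := by rw [h, Matrix.mul_one]
    _ = -φ' := by rw [← Matrix.mul_assoc, h1, Matrix.neg_mul, Matrix.one_mul]

/-- `(1 0; φ 1)` is `Q`-orthogonal iff `φ` is antisymmetric (`Q = (0 1; 1 0)`). -/
theorem shear_orthogonal_iff (φ : Matrix n n R) :
    (fromBlocks 1 0 φ 1 : Matrix (n ⊕ n) (n ⊕ n) R)ᵀ * fromBlocks 0 1 1 0 * fromBlocks 1 0 φ 1 =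
      fromBlocks 0 1 1 0 ↔ φᵀ = -φ := by
  have hcalc : (fromBlocks 1 0 φ 1 : Matrix (n ⊕ n) (n ⊕ n) R)ᵀ * fromBlocks 0 1 1 0 * fromBlocks 1 0 φ 1 =
      fromBlocks (φᵀ + φ) (1 : Matrix n n R) 1 0 := by
    simp only [fromBlocks_transpose, transpose_one, transpose_zero, fromBlocks_multiply, Matrix.mul_one,
      Matrix.one_mul, Matrix.mul_zero, Matrix.zero_mul, add_zero, zero_add]
  rw [hcalc, fromBlocks_inj]
  exact ⟨fun hh => eq_neg_of_add_eq_zero_left hh.1, fun hh => ⟨by rw [hh, neg_add_cancel], rfl, rfl, rfl⟩⟩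

/-- `(0 −φ₂⁻¹; φ₂ 0)` is `Q`-orthogonal for `φ₂` antisymmetric and invertible. -/
theorem j0_orthogonal {φ₂ φ₂' : Matrix n n R} (h2 : φ₂ᵀ = -φ₂) (h : φ₂ * φ₂' = 1) (h' : φ₂' * φ₂ = 1) :
    (fromBlocks 0 (-φ₂') φ₂ 0)ᵀ * fromBlocks 0 1 1 0 * fromBlocks 0 (-φ₂') φ₂ 0 = fromBlocks 0 1 1 0 := by
  have h2' : φ₂'ᵀ = -φ₂' := transpose_inv_of_antisymm h2 h
  simp only [fromBlocks_transpose, transpose_zero, transpose_neg, h2, h2', neg_neg, fromBlocks_multiply,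
    Matrix.mul_one, Matrix.mul_zero, Matrix.zero_mul, add_zero, zero_add, Matrix.neg_mul, Matrix.mul_neg, h, h',
    neg_zero]

/-- **`I_ω ∈ O(Λ_ℝ, Q_ℝ)`**: for `φ₁, φ₂` antisymmetric and `φ₂ φ₂' = 1 = φ₂' φ₂`, `I_ωᵀ Q I_ω = Q` — the orthogonal
half of «`I_ω ∈ U_{A,ℚ}(ℝ)`» [cite: GolyshevLuntsOrlov2001MirrorAV, §8.4 (14) with Prop. 5.2 3) (arXiv v2 pp. 19,
24)]. DERIVED HERE in the model. -/
theorem iomega_orthogonal {φ₁ φ₂ φ₂' : Matrix n n R} (h1 : φ₁ᵀ = -φ₁) (h2 : φ₂ᵀ = -φ₂)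
    (h : φ₂ * φ₂' = 1) (h' : φ₂' * φ₂ = 1) :
    (fromBlocks (φ₂' * φ₁) (-φ₂') (φ₂ + φ₁ * φ₂' * φ₁) (-(φ₁ * φ₂')))ᵀ * fromBlocks 0 1 1 0 *
      fromBlocks (φ₂' * φ₁) (-φ₂') (φ₂ + φ₁ * φ₂' * φ₁) (-(φ₁ * φ₂')) = fromBlocks 0 1 1 0 := by
  rw [iomega_eq_conj]
  exact conj_orthogonal _ _ _ _ (shear_neg_mul_shear φ₁) ((shear_orthogonal_iff φ₁).mpr h1)
    (j0_orthogonal h2 h h')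

/-- `J² = −1 ⟹ J_{A×Â}² = −1` for `J_{A×Â} = (J 0; 0 −Jᵀ)`. -/
theorem jAxAhat_sq {J : Matrix n n R} (hJ : J * J = -1) :
    fromBlocks J 0 0 (-Jᵀ) * fromBlocks J 0 0 (-Jᵀ) = -1 := by
  have hJt : Jᵀ * Jᵀ = -1 := by rw [← transpose_mul, hJ, transpose_neg, transpose_one]
  simp only [fromBlocks_multiply, Matrix.mul_zero, Matrix.zero_mul, add_zero, zero_add, Matrix.neg_mul,
    Matrix.mul_neg, neg_neg, hJ, hJt, neg_zero, fromBlocks_neg_one_eq]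

/-- «The operator `J_A` of complex structure on `Λ_ℝ` … preserves the form `Q`» (proof of Prop. 5.2 1)): for
`J² = −1`, `J_{A×Â}ᵀ Q J_{A×Â} = Q` [cite: GolyshevLuntsOrlov2001MirrorAV, Prop. 5.2, proof of 1) (arXiv v2 p. 20
L2–L4)]. DERIVED HERE in the model. -/
theorem jAxAhat_orthogonal {J : Matrix n n R} (hJ : J * J = -1) :
    (fromBlocks J 0 0 (-Jᵀ))ᵀ * fromBlocks 0 1 1 0 * fromBlocks J 0 0 (-Jᵀ) = fromBlocks 0 1 1 0 := by
  have hJt : Jᵀ * Jᵀ = -1 := by rw [← transpose_mul, hJ, transpose_neg, transpose_one]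
  simp only [fromBlocks_transpose, fromBlocks_multiply, transpose_zero, transpose_neg, transpose_transpose,
    Matrix.mul_zero, Matrix.zero_mul, add_zero, zero_add, Matrix.mul_one, Matrix.neg_mul, Matrix.mul_neg, hJ,
    hJt, neg_neg, neg_zero]

/-- `(1 0; φ 1)` commutes with `J_{A×Â}` when `φ` is of type (1,1) (`φ J + Jᵀ φ = 0`). -/
theorem shear_comm_J {φ J : Matrix n n R} (hφJ : φ * J + Jᵀ * φ = 0) :
    fromBlocks 1 0 φ 1 * fromBlocks J 0 0 (-Jᵀ) = fromBlocks J 0 0 (-Jᵀ) * fromBlocks 1 0 φ 1 := by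
  have hh : φ * J = -(Jᵀ * φ) := eq_neg_of_add_eq_zero_left hφJ
  simp only [fromBlocks_multiply, Matrix.mul_one, Matrix.one_mul, Matrix.mul_zero, Matrix.zero_mul, add_zero,
    zero_add, Matrix.neg_mul, hh]

/-- `(0 −φ₂⁻¹; φ₂ 0)` commutes with `J_{A×Â}` when `φ₂` is of type (1,1) and invertible. -/
theorem j0_comm_J {φ₂ φ₂' J : Matrix n n R} (h2J : φ₂ * J + Jᵀ * φ₂ = 0) (h : φ₂ * φ₂' = 1)
    (h' : φ₂' * φ₂ = 1) :
    fromBlocks 0 (-φ₂') φ₂ 0 * fromBlocks J 0 0 (-Jᵀ) = fromBlocks J 0 0 (-Jᵀ) * fromBlocks 0 (-φ₂') φ₂ 0 := by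
  have hJ1 : φ₂ * J = -(Jᵀ * φ₂) := eq_neg_of_add_eq_zero_left h2J
  have hJ2 : Jᵀ * φ₂ = -(φ₂ * J) := eq_neg_of_add_eq_zero_right h2J
  have hJ' : φ₂' * Jᵀ = -(J * φ₂') := by
    calc φ₂' * Jᵀ = φ₂' * Jᵀ * (φ₂ * φ₂') := by rw [h, Matrix.mul_one]
      _ = φ₂' * (Jᵀ * φ₂) * φ₂' := by simp only [Matrix.mul_assoc]
      _ = -(φ₂' * φ₂ * J * φ₂') := by rw [hJ2]; simp only [Matrix.mul_neg, Matrix.neg_mul, Matrix.mul_assoc]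
      _ = -(J * φ₂') := by rw [h', Matrix.one_mul]
  simp only [fromBlocks_multiply, Matrix.mul_zero, Matrix.zero_mul, add_zero, zero_add, Matrix.neg_mul,
    Matrix.mul_neg, neg_neg, hJ1, hJ']

/-- **`I_ω` and `J_{A×Â}` commute** («`J_{A×Â}`, `I_{ω_A}` … which commute and define two complex structures on
`V_A ⊕ V_Â`», §9.1): for `φ₁, φ₂` of type (1,1) w.r.t. `J` and `φ₂ φ₂' = 1 = φ₂' φ₂`
[cite: GolyshevLuntsOrlov2001MirrorAV, §9.1 (arXiv v2 p. 25 L3–L6)]. DERIVED HERE in the model. -/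
theorem iomega_comm_J {φ₁ φ₂ φ₂' J : Matrix n n R} (h1J : φ₁ * J + Jᵀ * φ₁ = 0) (h2J : φ₂ * J + Jᵀ * φ₂ = 0)
    (h : φ₂ * φ₂' = 1) (h' : φ₂' * φ₂ = 1) :
    fromBlocks (φ₂' * φ₁) (-φ₂') (φ₂ + φ₁ * φ₂' * φ₁) (-(φ₁ * φ₂')) * fromBlocks J 0 0 (-Jᵀ) =
      fromBlocks J 0 0 (-Jᵀ) * fromBlocks (φ₂' * φ₁) (-φ₂') (φ₂ + φ₁ * φ₂' * φ₁) (-(φ₁ * φ₂')) := by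
  rw [iomega_eq_conj]
  exact conj_comm _ _ _ _ (shear_neg_mul_shear φ₁) (shear_comm_J h1J) (j0_comm_J h2J h h')

end Iomega

section Lemma941

/-- **Lemma 9.4.1, proof l. 1–2** «Since `I² = −1` and `I ∈ U_{A,ℚ}(ℝ)` we have equalities `Î₁₂ = I₁₂`, `Î₂₁ = I₂₁`,
`Î₁₁ = −I₂₂`»: with `U_{A,ℚ} = Aut_ℚ(A × Â) ∩ SO(Λ_ℚ, Q_ℚ)` (Prop. 5.2 3)) and Rem. 1.6's hats (`Î₁₂ = −I₁₂ᵀ`,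
`Î₂₁ = −I₂₁ᵀ`, `Î₁₁ = I₁₁ᵀ`), `Iᵀ Q I = Q` and `I² = −1` give `I₁₂ᵀ = −I₁₂`, `I₂₁ᵀ = −I₂₁`, `I₁₁ᵀ = −I₂₂`
[cite: GolyshevLuntsOrlov2001MirrorAV, Lemma 9.4.1, proof (arXiv v2 p. 28 L1–L2)]. PROVED HERE in the model. -/
theorem blocks_of_orthogonal_sq_neg_one {I₁₁ I₁₂ I₂₁ I₂₂ : Matrix n n R}
    (hQ : (fromBlocks I₁₁ I₁₂ I₂₁ I₂₂)ᵀ * fromBlocks 0 1 1 0 * fromBlocks I₁₁ I₁₂ I₂₁ I₂₂ = fromBlocks 0 1 1 0)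
    (hsq : fromBlocks I₁₁ I₁₂ I₂₁ I₂₂ * fromBlocks I₁₁ I₁₂ I₂₁ I₂₂ = -1) :
    I₁₂ᵀ = -I₁₂ ∧ I₂₁ᵀ = -I₂₁ ∧ I₁₁ᵀ = -I₂₂ := by
  have key : fromBlocks (0 : Matrix n n R) 1 1 0 * fromBlocks I₁₁ I₁₂ I₂₁ I₂₂ =
      -((fromBlocks I₁₁ I₁₂ I₂₁ I₂₂)ᵀ * fromBlocks 0 1 1 0) := by
    calc fromBlocks (0 : Matrix n n R) 1 1 0 * fromBlocks I₁₁ I₁₂ I₂₁ I₂₂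
          = (fromBlocks I₁₁ I₁₂ I₂₁ I₂₂)ᵀ * fromBlocks 0 1 1 0 * fromBlocks I₁₁ I₁₂ I₂₁ I₂₂ *
              fromBlocks I₁₁ I₁₂ I₂₁ I₂₂ := by rw [hQ]
      _ = (fromBlocks I₁₁ I₁₂ I₂₁ I₂₂)ᵀ * fromBlocks 0 1 1 0 *
            (fromBlocks I₁₁ I₁₂ I₂₁ I₂₂ * fromBlocks I₁₁ I₁₂ I₂₁ I₂₂) := by simp only [Matrix.mul_assoc]
      _ = -((fromBlocks I₁₁ I₁₂ I₂₁ I₂₂)ᵀ * fromBlocks 0 1 1 0) := by rw [hsq, Matrix.mul_neg, Matrix.mul_one]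
  simp only [fromBlocks_transpose, fromBlocks_multiply, Matrix.zero_mul, Matrix.mul_zero, Matrix.one_mul,
    Matrix.mul_one, zero_add, add_zero, fromBlocks_neg, fromBlocks_inj] at key
  obtain ⟨h21, h22, _, h12⟩ := key
  exact ⟨neg_eq_iff_eq_neg.mp h12.symm, neg_eq_iff_eq_neg.mp h21.symm, neg_eq_iff_eq_neg.mp h22.symm⟩

/-- **Lemma 9.4.1, 2) ⇒ 1)** «Put `φ₂ = −I₁₂⁻¹` and `φ₁ = I₂₂I₁₂⁻¹` … It is easy to see that `I_ω = I`»: for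
`I² = −1` and `I₁₂ K = 1 = K I₁₂`, `I` IS display (14) with `φ₁ = I₂₂ K`, `φ₂ = −K`, `φ₂⁻¹ = −I₁₂`
[cite: GolyshevLuntsOrlov2001MirrorAV, Lemma 9.4.1, proof of 2) ⇒ 1) (arXiv v2 p. 28 L1–L3)]. PROVED HERE (the
identity uses `I² = −1` and the invertibility of `I₁₂` only). -/
theorem iomega_of_blocks {I₁₁ I₁₂ I₂₁ I₂₂ K : Matrix n n R}
    (hsq : fromBlocks I₁₁ I₁₂ I₂₁ I₂₂ * fromBlocks I₁₁ I₁₂ I₂₁ I₂₂ = -1) (hK : I₁₂ * K = 1) (hK' : K * I₁₂ = 1) :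
    fromBlocks I₁₁ I₁₂ I₂₁ I₂₂ =
      fromBlocks ((-I₁₂) * (I₂₂ * K)) (-(-I₁₂)) ((-K) + (I₂₂ * K) * (-I₁₂) * (I₂₂ * K))
        (-((I₂₂ * K) * (-I₁₂))) := by
  rw [← fromBlocks_neg_one_eq, fromBlocks_multiply, fromBlocks_inj] at hsq
  obtain ⟨_, h12, _, h22⟩ := hsq
  rw [fromBlocks_inj]
  refine ⟨?_, (neg_neg _).symm, ?_, ?_⟩
  · calc I₁₁ = I₁₁ * (I₁₂ * K) := by rw [hK, Matrix.mul_one]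
      _ = (I₁₁ * I₁₂ + I₁₂ * I₂₂) * K - I₁₂ * I₂₂ * K := by noncomm_ring
      _ = (-I₁₂) * (I₂₂ * K) := by rw [h12]; noncomm_ring
  · calc I₂₁ = I₂₁ * (I₁₂ * K) := by rw [hK, Matrix.mul_one]
      _ = (I₂₁ * I₁₂ + I₂₂ * I₂₂) * K - I₂₂ * I₂₂ * K := by noncomm_ring
      _ = (-1) * K - I₂₂ * (K * I₁₂) * I₂₂ * K := by rw [h22, hK']; noncomm_ring
      _ = (-K) + (I₂₂ * K) * (-I₁₂) * (I₂₂ * K) := by noncomm_ring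
  · calc I₂₂ = I₂₂ * (K * I₁₂) := by rw [hK', Matrix.mul_one]
      _ = -((I₂₂ * K) * (-I₁₂)) := by noncomm_ring

end Lemma941

section Displays

omit [DecidableEq n] in
/-- **Thm 10.5's `I_{tω}`** («`I_{tω} := (φ₂⁻¹φ₁ −t⁻¹φ₂⁻¹; t(φ₂ + φ₁φ₂⁻¹φ₁) −φ₁φ₂⁻¹)`»): display (14) at
`(tφ₁, tφ₂)` with `(tφ₂)⁻¹ = t⁻¹φ₂⁻¹`, for `t t' = 1` [cite: GolyshevLuntsOrlov2001MirrorAV, proof of Thm 10.5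
(arXiv v2 p. 34)]. PROVED HERE. -/
theorem iomega_real_scaling (φ₁ φ₂ φ₂' : Matrix n n R) {t t' : R} (ht : t * t' = 1) :
    fromBlocks ((t' • φ₂') * (t • φ₁)) (-(t' • φ₂')) (t • φ₂ + (t • φ₁) * (t' • φ₂') * (t • φ₁))
        (-((t • φ₁) * (t' • φ₂'))) =
      fromBlocks (φ₂' * φ₁) (-(t' • φ₂')) (t • (φ₂ + φ₁ * φ₂' * φ₁)) (-(φ₁ * φ₂')) := by
  have ht' : t' * t = 1 := by rw [mul_comm, ht]
  simp only [Matrix.smul_mul, Matrix.mul_smul, smul_smul, ht, ht', one_smul, smul_add]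

/-- `I_{tω} = diag(1, t) I_ω diag(1, t⁻¹)` (`t t' = 1`). DERIVED HERE. -/
theorem iomega_real_scaling_conj (φ₁ φ₂ φ₂' : Matrix n n R) {t t' : R} (ht : t * t' = 1) :
    fromBlocks 1 0 0 (t • (1 : Matrix n n R)) *
        fromBlocks (φ₂' * φ₁) (-φ₂') (φ₂ + φ₁ * φ₂' * φ₁) (-(φ₁ * φ₂')) * fromBlocks 1 0 0 (t' • 1) =
      fromBlocks (φ₂' * φ₁) (-(t' • φ₂')) (t • (φ₂ + φ₁ * φ₂' * φ₁)) (-(φ₁ * φ₂')) := by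
  have ht' : t' * t = 1 := by rw [mul_comm, ht]
  simp only [fromBlocks_multiply, Matrix.mul_one, Matrix.one_mul, Matrix.mul_zero, Matrix.zero_mul,
    Matrix.smul_mul, Matrix.mul_smul, add_zero, zero_add, smul_neg, smul_smul, ht', one_smul]

/-- **Proof of Prop. 9.6.1** (p. 29): for `ω_A = τφ`, `τ = a + ib`, i.e. `φ₁ = aφ`, `φ₂ = bφ`, `φ₂⁻¹ = b⁻¹φ⁻¹`:
«`I_{ω_A} = (b⁻¹a −b⁻¹φ⁻¹; (b + ab⁻¹a)φ −ab⁻¹)`» [cite: GolyshevLuntsOrlov2001MirrorAV, proof of Prop. 9.6.1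
(arXiv v2 p. 29)]. PROVED HERE (`φ φ' = 1 = φ' φ`; `b⁻¹` carried as `b'`; the scalar blocks `b⁻¹a = ab⁻¹` appear as
`(a b') • 1`, `(b' a) • 1` — equal in a commutative ring). -/
theorem iomega_scalar (φ φ' : Matrix n n R) (a b b' : R) (hφ : φ * φ' = 1) (hφ' : φ' * φ = 1) :
    fromBlocks ((b' • φ') * (a • φ)) (-(b' • φ')) (b • φ + (a • φ) * (b' • φ') * (a • φ))
        (-((a • φ) * (b' • φ'))) =
      fromBlocks ((a * b') • (1 : Matrix n n R)) (-(b' • φ')) ((b + a * b' * a) • φ) (-((b' * a) • 1)) := by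
  simp only [Matrix.smul_mul, Matrix.mul_smul, smul_smul, hφ, hφ', Matrix.one_mul, add_smul, mul_assoc]

/-- **7.3**: «`[φ, φ⁻¹] = h = (−1_A 0; 0 1_Â)`» for `φ ∈ NS_A(ℝ)⁰ ⊂ Hom(V_A, V_Â)` (lower-left block) and `φ⁻¹ ∈
Hom(V_Â, V_A)` (upper-right block), `φ φ' = 1 = φ' φ` [cite: GolyshevLuntsOrlov2001MirrorAV, 7.3 (arXiv v2 p. 23)].
PROVED HERE. -/
theorem ns_bracket_eq_h (φ φ' : Matrix n n R) (hφ : φ * φ' = 1) (hφ' : φ' * φ = 1) :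
    fromBlocks 0 0 φ 0 * fromBlocks 0 φ' 0 0 - fromBlocks 0 φ' 0 0 * fromBlocks 0 0 φ 0 =
      fromBlocks (-1) 0 0 (1 : Matrix n n R) := by
  simp only [fromBlocks_multiply, Matrix.mul_zero, Matrix.zero_mul, add_zero, zero_add, hφ, hφ', sub_eq_add_neg,
    fromBlocks_neg, fromBlocks_add, neg_zero]

omit [DecidableEq n] in
/-- **Proof of Prop. 10.1.4** (p. 31): «`(0 q₂⁻¹; −q₂ 0)(a b; c d)(0 −q₂⁻¹; q₂ 0) = (q₂⁻¹dq₂ −q₂⁻¹cq₂⁻¹; −q₂bq₂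
q₂aq₂⁻¹)`» — with `q₂⁻¹` an arbitrary `q₂'`, no hypothesis [cite: GolyshevLuntsOrlov2001MirrorAV, proof of Prop.
10.1.4 (arXiv v2 p. 31)]. PROVED HERE. -/
theorem j0_conj_blocks (q₂ q₂' a b c d : Matrix n n R) :
    fromBlocks 0 q₂' (-q₂) 0 * fromBlocks a b c d * fromBlocks 0 (-q₂') q₂ 0 =
      fromBlocks (q₂' * d * q₂) (-(q₂' * c * q₂')) (-(q₂ * b * q₂)) (q₂ * a * q₂') := by
  simp only [fromBlocks_multiply, Matrix.mul_zero, Matrix.zero_mul, add_zero, zero_add, Matrix.neg_mul,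
    Matrix.mul_neg, neg_neg, Matrix.mul_assoc]

end Displays

section Example

/-- Non-vacuity over `ℤ`, `n = Fin 2`: with `φ = (0 1; −1 0)` (`φ² = −1`, `φᵀ = −φ`) take `φ₁ = φ₂ = J = φ`,
`φ₂⁻¹ = −φ`; then every hypothesis above holds (`φ₂ φ₂' = 1 = φ₂' φ₂`, antisymmetry, type (1,1) `φ J + Jᵀ φ = 0`,
`J² = −1`), `I_ω = (1 φ; 2φ −1)`, `I_ω² = −1`, `I_ωᵀ Q I_ω = Q`, `I_ω J_{A×Â} = J_{A×Â} I_ω`, and `I_ω ≠ ±J_{A×Â}`.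
Checked by `decide`. -/
theorem example_integral :
    (!![0, 1; -1, 0] : Matrix (Fin 2) (Fin 2) ℤ) * (-!![0, 1; -1, 0]) = 1 ∧
    (-!![0, 1; -1, 0] : Matrix (Fin 2) (Fin 2) ℤ) * !![0, 1; -1, 0] = 1 ∧
    (!![0, 1; -1, 0] : Matrix (Fin 2) (Fin 2) ℤ)ᵀ = -!![0, 1; -1, 0] ∧
    (!![0, 1; -1, 0] : Matrix (Fin 2) (Fin 2) ℤ) * !![0, 1; -1, 0] + (!![0, 1; -1, 0])ᵀ * !![0, 1; -1, 0] = 0 ∧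
    (!![0, 1; -1, 0] : Matrix (Fin 2) (Fin 2) ℤ) * !![0, 1; -1, 0] = -1 ∧
    (fromBlocks ((-!![0, 1; -1, 0]) * !![0, 1; -1, 0]) (-(-!![0, 1; -1, 0]))
        (!![0, 1; -1, 0] + !![0, 1; -1, 0] * (-!![0, 1; -1, 0]) * !![0, 1; -1, 0])
        (-(!![0, 1; -1, 0] * (-!![0, 1; -1, 0]))) : Matrix (Fin 2 ⊕ Fin 2) (Fin 2 ⊕ Fin 2) ℤ) =
      fromBlocks 1 !![0, 1; -1, 0] !![0, 2; -2, 0] (-1) ∧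
    (fromBlocks 1 !![0, 1; -1, 0] !![0, 2; -2, 0] (-1) : Matrix (Fin 2 ⊕ Fin 2) (Fin 2 ⊕ Fin 2) ℤ) *
        fromBlocks 1 !![0, 1; -1, 0] !![0, 2; -2, 0] (-1) = -1 ∧
    (fromBlocks 1 !![0, 1; -1, 0] !![0, 2; -2, 0] (-1) : Matrix (Fin 2 ⊕ Fin 2) (Fin 2 ⊕ Fin 2) ℤ)ᵀ *
        fromBlocks 0 1 1 0 * fromBlocks 1 !![0, 1; -1, 0] !![0, 2; -2, 0] (-1) = fromBlocks 0 1 1 0 ∧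
    (fromBlocks 1 !![0, 1; -1, 0] !![0, 2; -2, 0] (-1) : Matrix (Fin 2 ⊕ Fin 2) (Fin 2 ⊕ Fin 2) ℤ) *
        fromBlocks !![0, 1; -1, 0] 0 0 (-(!![0, 1; -1, 0])ᵀ) =
      fromBlocks !![0, 1; -1, 0] 0 0 (-(!![0, 1; -1, 0])ᵀ) * fromBlocks 1 !![0, 1; -1, 0] !![0, 2; -2, 0] (-1) ∧
    (fromBlocks 1 !![0, 1; -1, 0] !![0, 2; -2, 0] (-1) : Matrix (Fin 2 ⊕ Fin 2) (Fin 2 ⊕ Fin 2) ℤ) ≠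
      fromBlocks !![0, 1; -1, 0] 0 0 (-(!![0, 1; -1, 0])ᵀ) ∧
    (fromBlocks 1 !![0, 1; -1, 0] !![0, 2; -2, 0] (-1) : Matrix (Fin 2 ⊕ Fin 2) (Fin 2 ⊕ Fin 2) ℤ) ≠
      -fromBlocks !![0, 1; -1, 0] 0 0 (-(!![0, 1; -1, 0])ᵀ) := by
  refine ⟨?_, ?_, ?_, ?_, ?_, ?_, ?_, ?_, ?_, ?_, ?_⟩ <;> decide

end Example

end Summit.Ventures.HSemireg.GolyshevLuntsOrlov
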